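import Summits.Ventures.CertifiedManyBodySolver.Rows.TorusCeilingSectors
import Summits.Ventures.CertifiedManyBodySolver.Rows.TorusCeilingTilt16bProduct
import Summits.Ventures.CertifiedManyBodySolver.Rows.TorusCeilingTilt16
import HarnessLib

/-!
# Spin-twisted torus ceiling V(d) — zero field and the tilted carriers `Λ₁₆′`, `Λ₁₆″` in every sector

HONEST FRAMING: first certified bounds; not a superconductivity verdict; every number certified or
labelled float.

Part V(c) (`TorusCeilingSectors`) bounds, from a square-lattice NN-Hubbard window certificate of the
Literature shape, the energy density of the spin-twisted torus `homHubbardSpinMag φ κ t U` in EVERY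
sector `(N↑, N↓) = (a, b)`. This file records the zero-field case and the two tilted 16-site carriers of
the CAL ceiling page in every sector (so far kernel-admissible only at `S^z = 0`:
`tilt16_minEnergyOn_div_ge_of_window_certificate`, `tilt16bTorus_minEnergyOn_div_ge_of_window_certificate`):
* `homTorus_minEnergyOn_upDownSector_div_ge_of_window_certificate` — `κ ≡ 1`: the plain torus
  `homHubbard φ t U` generated by any window-injective lattice map `φ` with non-degenerate hops, every
  sector, density rows at the mean filling `(a + b)/(2 N^{d'})`;
* `tilt16_minEnergyOn_upDownSector_div_ge_of_window_certificate` — `Λ₁₆′ = ℤ²/⟨(4,0),(1,4)⟩ ≅ ℤ/16`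
  with hops `{±1, ±4}` (`tiltHom16`), windows of coordinate spreads `≤ 3, ≤ 3`, every sector `(a, b)`,
  `a, b ≤ 16`;
* `minEnergyOn_homHubbard_tiltHom16b_upDown_le` — the fermionic product state over the four cosets:
  `min_{(4a,4b)} H₆₄ ≤ 4 · min_{(a,b)} H₁₆` for the four-copy presentation `tiltHom16b` of
  `Λ₁₆″ = ℤ²/⟨(4,0),(2,4)⟩` (Part V-d(ii) proved `a = b`; the proof is the same, the sector of a product
  of four `(a, b)` states being `(4a, 4b)` by `isInSector_prodFamily`);
* `tilt16bTorus_minEnergyOn_upDownSector_div_ge_of_window_certificate` — hence every spread-`(3,3)`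
  window certificate bounds `minEnergyOn (hamiltonian tilt16bGraph t U) (szSector (a+b) ((a−b)/2)) / 16`
  in EVERY sector, e.g. the CEILING-PAGE row `Λ₁₆″`, PP, `(N↑, N↓) = (7, 6)`.
Pattern: `TorusCeilingTilt16`, `TorusCeilingLatHom`, `TorusCeilingTilt16bProduct` with the Part V(c) master
in place of Part IV. The numerical rows are ED references (certified or labelled float), not part of
this file. [cite: Han2020Bootstrap, §3] [cite: Tasaki2020, §2.2] [cite: LiebPRL1989, proof of Theorem 1]
-/

noncomputable section

open Matrix Finset
open Literature.MathematicalPhysics.QuantumLattice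
open Literature.MathematicalPhysics.QuantumFieldTheory hiding Site
open Literature.MathematicalPhysics.QuantumManyBody.StateRelaxation
open Literature.Probability.LatticeModels
open HubbardWave0 JWEmbed TwoCluster
open scoped ComplexOrder ComplexConjugate

namespace Summit.Ventures.CertifiedManyBodySolver.Rows

/-! ### §1. Zero field: the plain torus generated by `φ`, every sector -/

section ZeroFieldSectors

variable {d d' N : ℕ} [NeZero N]

/-- **Window certificate ⇒ energy per site of the torus generated by `φ` in EVERY sector `(N↑, N↓) = (a, b)`**
(`a, b ≤ N^{d'}`; density rows at the mean filling `(a + b)/(2 N^{d'})`): the `κ ≡ 1` case of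
`homTorusSpinTwist_minEnergyOn_upDownSector_div_ge_of_window_certificate_avg`, rewritten with
`homHubbardSpinMag φ 1 = homHubbard φ`. `a = b` is Part IV's `homTorus_minEnergyOn_div_ge_of_window_certificate`.
[cite: Han2020Bootstrap, §3] [cite: LiebPRL1989, proof of Theorem 1] -/
theorem homTorus_minEnergyOn_upDownSector_div_ge_of_window_certificate (φ : Site d →+ TorusSite d' N) (t U : ℝ)
    (hd : Function.Injective (signedHop φ)) {nu nd : ℕ} (hnu : nu ≤ Fintype.card (FermionTorus d' N))
    (hnd : nd ≤ Fintype.card (FermionTorus d' N))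
    {Λ Λ' : Finset (Site d)} (hΛ : Λ ⊆ Λ')
    (hclosed : ∀ x ∈ Λ, ∀ i : Fin d, x + unitVec i ∈ Λ' ∧ x - unitVec i ∈ Λ')
    (h0 : thicken ({0} : Finset (Site d)) 1 ⊆ Λ') (hz : (0 : Site d) ∈ Λ')
    (hInj' : Set.InjOn φ ↑Λ')
    (μ : Fin 2 → ℝ) (ν : ℝ)
    {m : Type*} [Fintype m] [DecidableEq m] {Λm : Matrix m m ℂ} (hΛm : Λm.PosSemidef)
    (O : m → FermionOp Λ')
    {κ : Type*} (s : Finset κ) (B : κ → FermionOp Λ)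
    {ι : Type*} (tt : Finset ι) (v : ι → Site d) (hsh : ∀ l, shiftSet (v l) Λ ⊆ Λ') (Y : ι → FermionOp Λ)
    {γ : Type*} (u : Finset γ) (b : γ → ℂ) (cw : γ → List (Orb (PolySite Λ') × Bool))
    (hcw : ∀ j ∈ u, ladderCharge (cw j) ≠ 0 ∨ ladderSpinCharge (cw j) ≠ 0)
    {δ : Type*} (ah : Finset δ) (dc : δ → ℝ) (V : δ → FermionOp Λ')
    {κ'' : Type*} (w : Finset κ'') (a : κ'' → ℂ) (word : κ'' → List (Orb (PolySite Λ') × Bool)) {c : ℝ}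
    (hcert : fermionEmbed (PolySite.incl h0) ((hubbardFermionInteraction d t U).meanEnergyObs 1) -
        (c : ℂ) • (1 : FermionOp Λ') -
        ∑ σ : Fin 2, ((μ σ : ℝ) : ℂ) • (nAt 0 hz σ - ((ν : ℝ) : ℂ) • (1 : FermionOp Λ')) =
      gramForm Λm O +
        (∑ k ∈ s, ((hubbardFermionInteraction d t U).localHamiltonian Λ' * fermionEmbed (PolySite.incl hΛ) (B k) -
            fermionEmbed (PolySite.incl hΛ) (B k) * (hubbardFermionInteraction d t U).localHamiltonian Λ') +
          ∑ l ∈ tt, (fermionEmbed (PolySite.incl (hsh l)) (fermionEmbed (PolySite.shiftEmb (v l) Λ) (Y l)) -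
            fermionEmbed (PolySite.incl hΛ) (Y l)) +
          ∑ j ∈ u, b j • ladderWord (cw j)) +
        (∑ m' ∈ ah, ((dc m' : ℝ) : ℂ) • ((V m')ᴴ - V m') + ∑ k ∈ w, a k • ladderWord (word k))) :
    c - ∑ k ∈ w, ‖a k‖ + (∑ σ : Fin 2, μ σ) * (((nu : ℝ) + nd) / 2 / (N : ℝ) ^ d' - ν) ≤
      (homHubbard φ t U).minEnergyOn (szSector (nu + nd) (((nu : ℝ) - nd) / 2)) / (N : ℝ) ^ d' := by
  have h := homTorusSpinTwist_minEnergyOn_upDownSector_div_ge_of_window_certificate_avg φ t U 1 hd hnu hnd hΛ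
    hclosed h0 hz hInj' μ ν hΛm O s B tt v hsh Y u b cw hcw ah dc V w a word hcert
  rw [show (fun _ : TorusSite d' N => (1 : Fin d → Fin 2 → Circle)) = 1 from rfl,
    homHubbardSpinMag_one_eq_homHubbard φ hd] at h
  exact h

end ZeroFieldSectors

/-! ### §2. The tilted torus `Λ₁₆′ = ⟨(4,0),(1,4)⟩` (the ring `ℤ/16`, hops `±1, ±4`), every sector -/

section Tilt16Sectors

/-- **`Λ₁₆′` caps spread-`(3,3)` window certificates in EVERY sector `(N↑, N↓) = (a, b)`** (`a, b ≤ 16`;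
density rows at the mean filling `(a + b)/32`). `a = b` is `tilt16_minEnergyOn_div_ge_of_window_certificate`.
[cite: Han2020Bootstrap, §3] [cite: LiebPRL1989, proof of Theorem 1] -/
theorem tilt16_minEnergyOn_upDownSector_div_ge_of_window_certificate (t U : ℝ)
    {nu nd : ℕ} (hnu : nu ≤ Fintype.card (FermionTorus 1 16)) (hnd : nd ≤ Fintype.card (FermionTorus 1 16))
    {Λ Λ' : Finset (Site 2)} (hΛ : Λ ⊆ Λ')
    (hspread : ∀ x ∈ Λ', ∀ y ∈ Λ', |x 0 - y 0| ≤ (3 : ℤ) ∧ |x 1 - y 1| ≤ (3 : ℤ))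
    (hclosed : ∀ x ∈ Λ, ∀ i : Fin 2, x + unitVec i ∈ Λ' ∧ x - unitVec i ∈ Λ')
    (h0 : thicken ({0} : Finset (Site 2)) 1 ⊆ Λ') (hz : (0 : Site 2) ∈ Λ')
    (μ : Fin 2 → ℝ) (ν : ℝ)
    {m : Type*} [Fintype m] [DecidableEq m] {Λm : Matrix m m ℂ} (hΛm : Λm.PosSemidef)
    (O : m → FermionOp Λ')
    {κ : Type*} (s : Finset κ) (B : κ → FermionOp Λ)
    {ι : Type*} (tt : Finset ι) (v : ι → Site 2) (hsh : ∀ l, shiftSet (v l) Λ ⊆ Λ') (Y : ι → FermionOp Λ)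
    {γ : Type*} (u : Finset γ) (b : γ → ℂ) (cw : γ → List (Orb (PolySite Λ') × Bool))
    (hcw : ∀ j ∈ u, ladderCharge (cw j) ≠ 0 ∨ ladderSpinCharge (cw j) ≠ 0)
    {δ : Type*} (ah : Finset δ) (dc : δ → ℝ) (V : δ → FermionOp Λ')
    {κ'' : Type*} (w : Finset κ'') (a : κ'' → ℂ) (word : κ'' → List (Orb (PolySite Λ') × Bool)) {c : ℝ}
    (hcert : fermionEmbed (PolySite.incl h0) ((hubbardFermionInteraction 2 t U).meanEnergyObs 1) -
        (c : ℂ) • (1 : FermionOp Λ') -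
        ∑ σ : Fin 2, ((μ σ : ℝ) : ℂ) • (nAt 0 hz σ - ((ν : ℝ) : ℂ) • (1 : FermionOp Λ')) =
      gramForm Λm O +
        (∑ k ∈ s, ((hubbardFermionInteraction 2 t U).localHamiltonian Λ' * fermionEmbed (PolySite.incl hΛ) (B k) -
            fermionEmbed (PolySite.incl hΛ) (B k) * (hubbardFermionInteraction 2 t U).localHamiltonian Λ') +
          ∑ l ∈ tt, (fermionEmbed (PolySite.incl (hsh l)) (fermionEmbed (PolySite.shiftEmb (v l) Λ) (Y l)) -
            fermionEmbed (PolySite.incl hΛ) (Y l)) +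
          ∑ j ∈ u, b j • ladderWord (cw j)) +
        (∑ m' ∈ ah, ((dc m' : ℝ) : ℂ) • ((V m')ᴴ - V m') + ∑ k ∈ w, a k • ladderWord (word k))) :
    c - ∑ k ∈ w, ‖a k‖ + (∑ σ : Fin 2, μ σ) * (((nu : ℝ) + nd) / 2 / 16 - ν) ≤
      (homHubbard tiltHom16 t U).minEnergyOn (szSector (nu + nd) (((nu : ℝ) - nd) / 2)) / 16 := by
  have hInj' : Set.InjOn tiltHom16 ↑Λ' :=
    injOn_ringHom_two_of_spread 16 ![12, 1] (M₀ := 3) (M₁ := 3)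
      (fun a' b' h₁ h₂ h₃ h₄ h₅ => by
        simp only [Matrix.cons_val_zero, Matrix.cons_val_one] at h₅
        omega) hspread
  have hd : Function.Injective (signedHop tiltHom16) := injective_signedHop_ringHom 16 ![12, 1] (by decide)
  have h := homTorus_minEnergyOn_upDownSector_div_ge_of_window_certificate tiltHom16 t U hd hnu hnd hΛ hclosed h0 hz
    hInj' μ ν hΛm O s B tt v hsh Y u b cw hcw ah dc V w a word hcert
  simp only [Nat.cast_ofNat, pow_one] at h
  exact h

end Tilt16Sectors

/-! ### §3. The tilted torus `Λ₁₆″ = ⟨(4,0),(2,4)⟩`: four-coset product state and the 16-site cap, every sector -/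

section Tilt16bSectors

/-- **The product-state inequality in every sector**: the `(4a, 4b)`-sector ground energy of the 64-site
four-copy model `homHubbard tiltHom16b t U` is at most four times the `(a, b)`-sector ground energy of ONE
16-site copy `hamiltonian tilt16bGraph t U` (`a, b ≤ 16`): the product of four copies of an `(a, b)`
sector ground state is a trial state of sector `(4a, 4b)` (`isInSector_prodFamily`). `a = b` is
`minEnergyOn_homHubbard_tiltHom16b_le`. [cite: Tasaki2020, §2.2] -/
theorem minEnergyOn_homHubbard_tiltHom16b_upDown_le (t U : ℝ) {nu nd : ℕ}
    (hnu : nu ≤ Fintype.card (FermionTorus 1 16)) (hnd : nd ≤ Fintype.card (FermionTorus 1 16)) :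
    (homHubbard tiltHom16b t U).minEnergyOn
        (szSector (4 * nu + 4 * nd) ((((4 * nu : ℕ) : ℝ) - ((4 * nd : ℕ) : ℝ)) / 2)) ≤
      4 * (hamiltonian tilt16bGraph t U).minEnergyOn (szSector (nu + nd) (((nu : ℝ) - nd) / 2)) := by
  classical
  set H₁ := hamiltonian tilt16bGraph t U with hH₁
  set E₁ : ℝ := H₁.minEnergyOn (szSector (nu + nd) (((nu : ℝ) - nd) / 2)) with hE₁
  have hHc := hamiltonian_isHermitian_and_commute_holds tilt16bGraph t U
  have hH₁h : H₁.IsHermitian := hHc.1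
  have hK : (szSector (nu + nd) (((nu : ℝ) - nd) / 2) : Submodule ℂ (Fock (Orb (FermionTorus 1 16)))) ≠ ⊥ :=
    Literature.MathematicalPhysics.QuantumChemistry.szSector_upDown_ne_bot hnu hnd
  obtain ⟨ψ, hψK, hψ1, hHψ⟩ := exists_unit_eigen_minEnergyOn hH₁h (szSector (nu + nd) (((nu : ℝ) - nd) / 2))
    (fun v hv => mulVec_mem_szSector_of_commute hHc.2.1 hHc.2.2 hv) hK
  have hψin : IsInSector nu nd ψ := (mem_szSector_iff_isInSector nu nd ψ).1 hψK
  set Ψ : Fock (Orb (FermionTorus 2 8)) := tilt16bPartition.prodFamily (fun _ : Fin 4 => ψ) with hΨ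
  have hΨin : IsInSector (4 * nu) (4 * nd) Ψ := isInSector_prodFamily fun _ => hψin
  have hΨK : Ψ ∈ (szSector (4 * nu + 4 * nd) ((((4 * nu : ℕ) : ℝ) - ((4 * nd : ℕ) : ℝ)) / 2) :
      Submodule ℂ (Fock (Orb (FermionTorus 2 8)))) :=
    (mem_szSector_iff_isInSector (4 * nu) (4 * nd) Ψ).2 hΨin
  have hΨ1 : star Ψ ⬝ᵥ Ψ = 1 := tilt16bPartition.star_prodFamily_dotProduct_self _ fun _ => hψ1
  have hHΨ : homHubbard tiltHom16b t U *ᵥ Ψ = (∑ _r : Fin 4, ((E₁ : ℝ) : ℂ)) • Ψ := by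
    rw [homHubbard_tiltHom16b_eq_sum_jwEmbed]
    exact tilt16bPartition.sum_jwEmbed_mulVec_prodFamily_of_eigenvector
      (fun _ => isParityPreserving_hamiltonian tilt16bGraph t U) (fun _ => hHψ)
  have hsum : (∑ _r : Fin 4, ((E₁ : ℝ) : ℂ)) = (((4 * E₁ : ℝ)) : ℂ) := by
    rw [Finset.sum_const, Finset.card_univ, Fintype.card_fin]
    push_cast
    ring
  have hray : (star Ψ ⬝ᵥ homHubbard tiltHom16b t U *ᵥ Ψ).re = 4 * E₁ := by
    rw [hHΨ, hsum, dotProduct_smul, hΨ1, smul_eq_mul, mul_one, Complex.ofReal_re]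
  calc (homHubbard tiltHom16b t U).minEnergyOn
        (szSector (4 * nu + 4 * nd) ((((4 * nu : ℕ) : ℝ) - ((4 * nd : ℕ) : ℝ)) / 2))
      ≤ (star Ψ ⬝ᵥ homHubbard tiltHom16b t U *ᵥ Ψ).re :=
        minEnergyOn_le_rayleigh_of_mem (homHubbard_isHermitian tiltHom16b t U) _ hΨK hΨ1
    _ = 4 * E₁ := hray

/-- **The 16-site tilted torus `Λ₁₆″ = ⟨(4,0),(2,4)⟩` caps spread-`(3,3)` window certificates in EVERY
sector `(N↑, N↓) = (a, b)`** (`a, b ≤ 16`; density rows at the mean filling `(a + b)/32`): for every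
square-lattice NN-Hubbard window certificate (exactly the data of
`groundEnergyAt_div_ge_of_window_certificate`) whose outer window `Λ'` has coordinate spreads `≤ 3, ≤ 3`,
`c − Σ‖a_k‖ + (Σ_σ μ_σ)((a + b)/32 − ν) ≤ minEnergyOn H₁₆ (szSector (a+b) ((a−b)/2))/16`
(`H₁₆ = hamiltonian tilt16bGraph t U`), by §1 on the 64-site four-copy carrier `tiltHom16b` in the sector
`(4a, 4b)`, then the product-state inequality. `a = b` is `tilt16bTorus_minEnergyOn_div_ge_of_window_certificate`;
the CEILING-PAGE row `Λ₁₆″`, PP, `(7, 6)` is `(a, b) = (7, 6)`. [cite: Han2020Bootstrap, §3] [cite: Tasaki2020, §2.2] -/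
theorem tilt16bTorus_minEnergyOn_upDownSector_div_ge_of_window_certificate (t U : ℝ)
    {nu nd : ℕ} (hnu : nu ≤ Fintype.card (FermionTorus 1 16)) (hnd : nd ≤ Fintype.card (FermionTorus 1 16))
    {Λ Λ' : Finset (Site 2)} (hΛ : Λ ⊆ Λ')
    (hspread : ∀ x ∈ Λ', ∀ y ∈ Λ', |x 0 - y 0| ≤ (3 : ℤ) ∧ |x 1 - y 1| ≤ (3 : ℤ))
    (hclosed : ∀ x ∈ Λ, ∀ i : Fin 2, x + unitVec i ∈ Λ' ∧ x - unitVec i ∈ Λ')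
    (h0 : thicken ({0} : Finset (Site 2)) 1 ⊆ Λ') (hz : (0 : Site 2) ∈ Λ')
    (μ : Fin 2 → ℝ) (ν : ℝ)
    {m : Type*} [Fintype m] [DecidableEq m] {Λm : Matrix m m ℂ} (hΛm : Λm.PosSemidef)
    (O : m → FermionOp Λ')
    {κ : Type*} (s : Finset κ) (B : κ → FermionOp Λ)
    {ι : Type*} (tt : Finset ι) (v : ι → Site 2) (hsh : ∀ l, shiftSet (v l) Λ ⊆ Λ') (Y : ι → FermionOp Λ)
    {γ : Type*} (u : Finset γ) (b : γ → ℂ) (cw : γ → List (Orb (PolySite Λ') × Bool))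
    (hcw : ∀ j ∈ u, ladderCharge (cw j) ≠ 0 ∨ ladderSpinCharge (cw j) ≠ 0)
    {δ : Type*} (ah : Finset δ) (dc : δ → ℝ) (V : δ → FermionOp Λ')
    {κ'' : Type*} (w : Finset κ'') (a : κ'' → ℂ) (word : κ'' → List (Orb (PolySite Λ') × Bool)) {c : ℝ}
    (hcert : fermionEmbed (PolySite.incl h0) ((hubbardFermionInteraction 2 t U).meanEnergyObs 1) -
        (c : ℂ) • (1 : FermionOp Λ') -
        ∑ σ : Fin 2, ((μ σ : ℝ) : ℂ) • (nAt 0 hz σ - ((ν : ℝ) : ℂ) • (1 : FermionOp Λ')) =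
      gramForm Λm O +
        (∑ k ∈ s, ((hubbardFermionInteraction 2 t U).localHamiltonian Λ' * fermionEmbed (PolySite.incl hΛ) (B k) -
            fermionEmbed (PolySite.incl hΛ) (B k) * (hubbardFermionInteraction 2 t U).localHamiltonian Λ') +
          ∑ l ∈ tt, (fermionEmbed (PolySite.incl (hsh l)) (fermionEmbed (PolySite.shiftEmb (v l) Λ) (Y l)) -
            fermionEmbed (PolySite.incl hΛ) (Y l)) +
          ∑ j ∈ u, b j • ladderWord (cw j)) +
        (∑ m' ∈ ah, ((dc m' : ℝ) : ℂ) • ((V m')ᴴ - V m') + ∑ k ∈ w, a k • ladderWord (word k))) :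
    c - ∑ k ∈ w, ‖a k‖ + (∑ σ : Fin 2, μ σ) * (((nu : ℝ) + nd) / 2 / 16 - ν) ≤
      (hamiltonian tilt16bGraph t U).minEnergyOn (szSector (nu + nd) (((nu : ℝ) - nd) / 2)) / 16 := by
  have h16 : Fintype.card (FermionTorus 1 16) = 16 := by simp [FermionTorus, Fintype.card_lex]
  have h64c : Fintype.card (FermionTorus 2 8) = 64 := by simp [FermionTorus, Fintype.card_lex]
  have hnu4 : 4 * nu ≤ Fintype.card (FermionTorus 2 8) := by
    rw [h64c]
    rw [h16] at hnu
    omega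
  have hnd4 : 4 * nd ≤ Fintype.card (FermionTorus 2 8) := by
    rw [h64c]
    rw [h16] at hnd
    omega
  have hInj' : Set.InjOn tiltHom16b ↑Λ' :=
    injOn_latHom_two_two_of_spread 8 ![![4, 0], ![2, 1]] (M₀ := 3) (M₁ := 3)
      (fun a' b' h₁ h₂ h₃ h₄ h₅ h₆ => by
        simp only [Matrix.cons_val_zero, Matrix.cons_val_one] at h₅ h₆
        omega) hspread
  have hd : Function.Injective (signedHop tiltHom16b) :=
    injective_signedHop_latHom 8 ![![4, 0], ![2, 1]] (by decide)
  have h64 := homTorus_minEnergyOn_upDownSector_div_ge_of_window_certificate tiltHom16b t U hd hnu4 hnd4 hΛ hclosed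
    h0 hz hInj' μ ν hΛm O s B tt v hsh Y u b cw hcw ah dc V w a word hcert
  have hprod := minEnergyOn_homHubbard_tiltHom16b_upDown_le t U hnu hnd
  have hV : ((8 : ℕ) : ℝ) ^ 2 = 64 := by norm_num
  have hq : ((((4 * nu : ℕ) : ℝ)) + ((4 * nd : ℕ) : ℝ)) / 2 / 64 = ((nu : ℝ) + nd) / 2 / 16 := by
    push_cast
    ring
  rw [hV, hq] at h64
  calc c - ∑ k ∈ w, ‖a k‖ + (∑ σ : Fin 2, μ σ) * (((nu : ℝ) + nd) / 2 / 16 - ν)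
      ≤ (homHubbard tiltHom16b t U).minEnergyOn
          (szSector (4 * nu + 4 * nd) ((((4 * nu : ℕ) : ℝ) - ((4 * nd : ℕ) : ℝ)) / 2)) / 64 := h64
    _ ≤ 4 * (hamiltonian tilt16bGraph t U).minEnergyOn (szSector (nu + nd) (((nu : ℝ) - nd) / 2)) / 64 :=
        div_le_div_of_nonneg_right hprod (by norm_num)
    _ = (hamiltonian tilt16bGraph t U).minEnergyOn (szSector (nu + nd) (((nu : ℝ) - nd) / 2)) / 16 := by ring

end Tilt16bSectors

end Summit.Ventures.CertifiedManyBodySolver.Rows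

end
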